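import Summits.MatrixMultiplication.MatrixMultiplication.Theses.DefinableSTPPDichotomy
import Literature.ModelTheory.PseudofiniteFields.DefinableSetsFiniteFieldsDecomposition
import Literature.ModelTheory.PseudofiniteFields.DefinableExponentialSums

/-!
# Normal form of a ring formula over large finite fields, from CDM 1992 Prop. (2.7)

Route `MatrixMultiplication/DefinableSTPPDichotomy`, crux `stmt-MatrixMultiplication-17884`
(`HexagonClearanceR`), line `Sketch`; registered stub `stub_normalForm_of_prop27`.

From the tree's named fact `ChatzidakisVanDenDriesMacintyre1992_prop27` (Chatzidakis–van den
Dries–Macintyre 1992, Prop. (2.7), pseudo-finite clause, taken as the hypothesis `h27`) we derive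
the concrete normal form used downstream: for a ring formula `φ(w; y)` (`w ∈ F^m` set variables,
`y ∈ F^n` parameters) there are `L, D, Q` such that in every finite field `F` with `Q ≤ |F|`, for
every `y` there are polynomials `G_l ∈ F[W_1, …, W_m, T]` (`l < L`) of total degree `≤ D` with
`φ(w; y) ↔ ⋀_l ∃ t, G_l(w, t) = 0` for all `w`.

Proof (bookkeeping over proved tree theorems): `prop27_finite_of_psf` (pseudo-finite clause ⇒
finite-field clause, compactness), `positiveQE_of_prop27` (merge parameters with an enrichment
of the field, `exists_enrichment`), `exists_mvPolynomial_of_term` (a ring term with specialised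
parameters is a polynomial of bounded degree; the bound variable `T` is adjoined to the set
variables as the last coordinate `Fin.snoc w t`), and `realize_iff_of_compatibleRing` (the given
compatible ring structure on `F` realises formulas as the canonical one does).
-/

set_option linter.dupNamespace false

namespace Summit.MatrixMultiplication.MatrixMultiplication.Theorems.HexagonClearanceR

open Literature.ModelTheory.PseudofiniteFields
open FirstOrder FirstOrder.Language FirstOrder.Ring

namespace NormalForm

/-- A ring term `τ(w, c, T)` in set variables `w ∈ K^m`, parameter variables `c ∈ K^{n'}` and
one bound variable `T`, once the parameters are specialised, is (the evaluation at
`Fin.snoc w t` of) a polynomial over `K` in `m + 1` variables whose total degree is bounded in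
terms of `τ` alone. [folklore] -/
theorem exists_mvPolynomial_snoc_of_term {m n' : ℕ}
    (τ : Language.ring.Term ((Fin m ⊕ Fin n') ⊕ Fin 1)) :
    ∃ D : ℕ, ∀ (K : Type) [Field K] (c : Fin n' → K), ∃ P : MvPolynomial (Fin (m + 1)) K,
      P.totalDegree ≤ D ∧ ∀ (w : Fin m → K) (t : K),
        MvPolynomial.eval (Fin.snoc w t : Fin (m + 1) → K) P =
          (letI := compatibleRingOfRing K; τ.realize (Sum.elim (Sum.elim w c) fun _ => t)) := by
  obtain ⟨D, hD⟩ := exists_mvPolynomial_of_term (m := m + 1) (n := n')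
    (τ.relabel (Sum.elim
      (Sum.elim (fun i => Sum.inl (Sum.inl (Fin.castSucc i))) (fun j => Sum.inl (Sum.inr j)))
      (fun _ => Sum.inl (Sum.inl (Fin.last m)))))
  refine ⟨D, fun K _ c => ?_⟩
  obtain ⟨P, hP, hPe⟩ := hD K c
  refine ⟨P, hP, fun w t => ?_⟩
  letI := compatibleRingOfRing K
  rw [hPe, Term.realize_relabel]
  congr 1
  funext a
  rcases a with (i | j) | u
  · simp
  · simp
  · simp

end NormalForm

/-- Stub 5: the normal form `φ(w; y) ↔ ⋀_l ∃t G_l(w, t) = 0` (polynomials over `F` of bounded degree,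
coefficients depending on the parameters and an enrichment) in all large finite fields, from CDM 1992
Prop. (2.7) (tree named fact) via the tree's `prop27_finite_of_psf`. -/
theorem stub_normalForm_of_prop27
    (h27 : ChatzidakisVanDenDriesMacintyre1992_prop27) :
    (∀ (m n : ℕ) (φ : FirstOrder.Language.ring.Formula (Fin m ⊕ Fin n)),
        ∃ (L D Q : ℕ), ∀ (F : Type) [Field F] [Fintype F] [FirstOrder.Ring.CompatibleRing F],
        Q ≤ Fintype.card F → ∀ (y : Fin n → F), ∃ G : Fin L → MvPolynomial (Fin (m + 1)) F,
          (∀ l, (G l).totalDegree ≤ D) ∧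
          ∀ w : Fin m → F, (φ.Realize (Sum.elim w y) ↔
            ∀ l, ∃ t : F, MvPolynomial.eval (Fin.snoc w t : Fin (m + 1) → F) (G l) = 0)) := by
  intro m n φ
  obtain ⟨q₀, n', L, g, hg⟩ := positiveQE_of_prop27 (prop27_finite_of_psf h27) m n φ
  have hD := fun l => NormalForm.exists_mvPolynomial_snoc_of_term (g l)
  choose D hD using hD
  refine ⟨L, Finset.univ.sup D, q₀, fun F _ _ _ hq y => ?_⟩
  obtain ⟨c', hc'⟩ := hg F hq y
  have hP := fun l => hD l F c'
  choose P hPdeg hPev using hP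
  refine ⟨P, fun l => (hPdeg l).trans (Finset.le_sup (Finset.mem_univ l)), fun w => ?_⟩
  rw [realize_iff_of_compatibleRing φ (Sum.elim w y), hc' w]
  refine forall_congr' fun l => exists_congr fun t => ?_
  rw [hPev l w t]

end Summit.MatrixMultiplication.MatrixMultiplication.Theorems.HexagonClearanceR
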